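import Literature.Geometry.Symplectic.GirouxContactPathFlat
import Literature.Geometry.Manifold.SmoothEmbeddingInverse
import Literature.Topology.FourManifolds.DehnSurgeryTubularNbhdProofs
import Mathlib.Analysis.Normed.Module.Connected
import HarnessLib

/-!
# Giroux's path of contact forms, IV: the binding tubes of an open book

Topic `Literature/Geometry/Symplectic`.  Fourth file of the proof of
`Literature.Geometry.Symplectic.GirouxContactPath` (Etnyre 2006, Prop. 3.5/3.18).  Etnyre's proof
works "near each component of the binding" in coordinates `(ψ, (r, θ))` on `S¹ × D²` in which the
fibration is `θ`; for the tree's `OpenBook` (`PlanarContactBoundary.lean`) these coordinates are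
the tubes `tube i : 𝕊¹ × ℝ² → M` with the normal form `proj (tube i (x, w)) = w / ‖w‖`.  This file
sets up that coordinate system as maps between manifolds:

* `OpenBook.range_core_eq_or_disjoint` — two binding components (cores of tubes) coincide or
  are disjoint, so that one may keep one tube per component: `OpenBook.reindex` (same binding,
  same fibration, `OpenBook.exists_reindex` with pairwise disjoint cores) and
  `OpenBook.IsGirouxForm.reindex`;
* `OpenBook.param i : ℝ³ → M`, `p = (ψ, x, y) ↦ tube i (e^{iψ}, (x, y))`, the flat
  parametrisation of the `i`-th tube (`contMDiff_param`), with its frame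
  `d(param) e₀ = c • ∂_ψ tube` (`c ≠ 0`), `d(param) e₁ = ∂_{w₁} tube`, `d(param) e₂ = ∂_{w₂} tube`
  (`mfderiv_param_apply`), so that at `x = y = 0` the frame is `(c • coreTangent, discFrame 0,
  discFrame 1)` of the Giroux binding condition;
* `OpenBook.qmap i : M → ℝ²`, `tube i (x, w) ↦ w` (the inverse of the smooth embedding `tube i`
  followed by the projection; smooth on the open set `range (tube i)`,
  `contMDiffAt_qmap`), `qmap ∘ param = πw`, and `OpenBook.rhoN i = ‖qmap i‖²` (`= r²`).

Everything is proved; the definitions are the coordinate maps just listed and `mk3`.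

## References

* J. B. Etnyre, *Lectures on open book decompositions and contact structures* (2006), proof of
  Lemma 3.3 ("near each component of the binding we can choose coordinates `(ψ, (r, θ))` …").
  [Etnyre2006]
-/

noncomputable section

open scoped Manifold ContDiff Topology
open Set Function
open Literature.Geometry.Kaehler Literature.Topology.FourManifolds

namespace Literature.Geometry.Symplectic

/-- Local notation: `𝔼 n` is the model Euclidean space `EuclideanSpace ℝ (Fin n)`. -/
local notation "𝔼 " n:arg => EuclideanSpace ℝ (Fin n)

/-- Local notation: `𝕊 n` is the unit sphere in `EuclideanSpace ℝ (Fin (n + 1))`. -/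
local notation "𝕊 " n:arg => (Metric.sphere (0 : EuclideanSpace ℝ (Fin (n + 1))) 1)

attribute [local instance] Literature.Topology.FourManifolds.fact_finrank_euclideanSpace_two

universe u

variable {M : Type u} [TopologicalSpace M] [ChartedSpace (𝔼 3) M] [IsManifold (𝓡 3) ∞ M]

namespace OpenBook

variable (ob : OpenBook M)

/-! ### Binding components coincide or are disjoint; one tube per component -/

/-- The range of a core is the set of points `tube i (x, 0)`. [folklore] -/
theorem range_core (i : Fin ob.k) : range (ob.core i) = range fun x : 𝕊 1 => ob.tube i (x, 0) := rfl

/-- A binding point lying in the (open) image of the `i`-th tube lies on its core. [folklore] -/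
theorem mem_range_core_of_mem_range_tube {i : Fin ob.k} {y : M} (hyB : y ∈ ob.binding)
    (hy : y ∈ range (ob.tube i)) : y ∈ range (ob.core i) := by
  obtain ⟨⟨x, w⟩, rfl⟩ := hy
  obtain ⟨j, x', hx'⟩ := (ob.mem_binding_iff _).1 hyB
  have hw : w = 0 := ob.eq_zero_of_tube_eq i j x x' w hx'.symm
  exact ⟨x, by rw [hw]; rfl⟩

/-- **Two binding components coincide or are disjoint.** If the core of tube `j` meets the core
of tube `i`, then it is contained in it: the set of parameters `x ∈ 𝕊¹` with `core j x ∈ core i` is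
closed (cores are compact) and open (the binding meets the open set `range (tube i)` exactly in
`core i`), and `𝕊¹` is connected. [folklore] -/
theorem range_core_subset_of_not_disjoint [T2Space M] {i j : Fin ob.k}
    (h : ¬ Disjoint (range (ob.core i)) (range (ob.core j))) :
    range (ob.core j) ⊆ range (ob.core i) := by
  set A : Set (𝕊 1) := {x | ob.core j x ∈ range (ob.core i)} with hA
  have hAclosed : IsClosed A :=
    (isCompact_range (ob.continuous_core i)).isClosed.preimage (ob.continuous_core j)
  have hAopen : IsOpen A := by
    rw [isOpen_iff_mem_nhds]
    intro x hx
    have hxi : ob.core j x ∈ range (ob.tube i) := by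
      obtain ⟨x', hx'⟩ := hx
      exact ⟨(x', 0), hx'⟩
    have hnhds : (ob.core j) ⁻¹' range (ob.tube i) ∈ 𝓝 x :=
      (ob.continuous_core j).continuousAt.preimage_mem_nhds ((ob.isOpen_range_tube i).mem_nhds hxi)
    filter_upwards [hnhds] with x' hx'
    exact ob.mem_range_core_of_mem_range_tube (ob.core_mem_binding j x') hx'
  have hpre : PreconnectedSpace (𝕊 1) := by
    rw [← isPreconnected_iff_preconnectedSpace]
    have h2 : 1 < Module.rank ℝ (𝔼 2) := by
      rw [← Module.finrank_eq_rank, finrank_euclideanSpace_fin]; norm_num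
    exact isPreconnected_sphere h2 0 1
  have hAne : A.Nonempty := by
    rw [Set.not_disjoint_iff] at h
    obtain ⟨y, hyi, ⟨x, rfl⟩⟩ := h
    exact ⟨x, hyi⟩
  have hAuniv : A = univ := by
    rcases isClopen_iff.1 ⟨hAclosed, hAopen⟩ with h0 | h1
    · exact absurd h0 hAne.ne_empty
    · exact h1
  rintro _ ⟨x, rfl⟩
  have : x ∈ A := by rw [hAuniv]; exact mem_univ x
  exact this

/-- Two binding components coincide or are disjoint. [folklore] -/
theorem range_core_eq_or_disjoint [T2Space M] (i j : Fin ob.k) :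
    range (ob.core i) = range (ob.core j) ∨ Disjoint (range (ob.core i)) (range (ob.core j)) := by
  by_cases h : Disjoint (range (ob.core i)) (range (ob.core j))
  · exact Or.inr h
  · refine Or.inl (Subset.antisymm ?_ (ob.range_core_subset_of_not_disjoint h))
    exact ob.range_core_subset_of_not_disjoint (fun h' => h h'.symm)

/-- The binding of a reindexed family of tubes covering all components is the binding.
[folklore] -/
theorem tubesBinding_reindex {k' : ℕ} (f : Fin k' → Fin ob.k)
    (hcover : ∀ j, ∃ a, range (ob.core (f a)) = range (ob.core j)) :
    tubesBinding (fun a => ob.tube (f a)) = ob.binding := by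
  ext y
  simp only [mem_tubesBinding_iff, ob.mem_binding_iff]
  constructor
  · rintro ⟨a, x, rfl⟩
    exact ⟨f a, x, rfl⟩
  · rintro ⟨j, x, rfl⟩
    obtain ⟨a, ha⟩ := hcover j
    have : ob.tube j (x, 0) ∈ range (ob.core (f a)) := by rw [ha]; exact ⟨x, rfl⟩
    obtain ⟨x', hx'⟩ := this
    exact ⟨a, x', hx'⟩

/-- **Keeping one tube per binding component**: the open book with tubes `tube (f a)`, for a
reindexing `f` whose cores still cover the binding (same binding, same fibration `proj`).
[folklore] -/
def reindex {k' : ℕ} (hk' : 0 < k') (f : Fin k' → Fin ob.k)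
    (hcover : ∀ j, ∃ a, range (ob.core (f a)) = range (ob.core j)) : OpenBook M where
  k := k'
  k_pos := hk'
  tube a := ob.tube (f a)
  proj := ob.proj
  isSmoothEmbedding_tube a := ob.isSmoothEmbedding_tube (f a)
  isOpen_range_tube a := ob.isOpen_range_tube (f a)
  eq_zero_of_tube_eq a b x y w h := ob.eq_zero_of_tube_eq (f a) (f b) x y w h
  proj_tube a := ob.proj_tube (f a)
  contMDiffOn_proj := by
    rw [ob.tubesBinding_reindex f hcover]
    exact ob.contMDiffOn_proj
  angularDeriv_ne_zero y hy := by
    rw [ob.tubesBinding_reindex f hcover] at hy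
    exact ob.angularDeriv_ne_zero y hy

/-- The reindexed open book has the same binding. [folklore] -/
theorem reindex_binding {k' : ℕ} (hk' : 0 < k') (f : Fin k' → Fin ob.k)
    (hcover : ∀ j, ∃ a, range (ob.core (f a)) = range (ob.core j)) :
    (ob.reindex hk' f hcover).binding = ob.binding :=
  ob.tubesBinding_reindex f hcover

/-- **A Giroux form stays a Giroux form for the reindexed open book** (same binding, same
fibration, and the binding condition is asked tube by tube). [folklore] -/
theorem IsGirouxForm.reindex {ob : OpenBook M} {ξ : M → Submodule ℝ (𝔼 3)}
    {α : MForm (𝓡 3) M ℝ 1} (h : ob.IsGirouxForm ξ α) {k' : ℕ} (hk' : 0 < k')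
    (f : Fin k' → Fin ob.k) (hcover : ∀ j, ∃ a, range (ob.core (f a)) = range (ob.core j)) :
    (ob.reindex hk' f hcover).IsGirouxForm ξ α where
  smooth := h.smooth
  ker_eq := h.ker_eq
  contact := h.contact
  pages y hy := by
    rw [ob.reindex_binding hk' f hcover] at hy
    exact h.pages y hy
  binding a x := h.binding (f a) x

/-- **Existence of a reindexing with pairwise disjoint cores** (keep, in each class of tubes
with the same core, the tube of smallest index). [folklore] -/
theorem exists_reindex [T2Space M] :
    ∃ (k' : ℕ) (_ : 0 < k') (f : Fin k' → Fin ob.k),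
      (∀ j, ∃ a, range (ob.core (f a)) = range (ob.core j)) ∧
        Pairwise fun a b => Disjoint (range (ob.core (f a))) (range (ob.core (f b))) := by
  classical
  set S : Finset (Fin ob.k) :=
    Finset.univ.filter fun i => ∀ j, j < i → range (ob.core j) ≠ range (ob.core i) with hS
  have hmemS : ∀ i, i ∈ S ↔ ∀ j, j < i → range (ob.core j) ≠ range (ob.core i) := fun i => by
    simp [hS]
  have h0 : (⟨0, ob.k_pos⟩ : Fin ob.k) ∈ S := by
    rw [hmemS]
    intro j hj
    exact absurd hj (Nat.not_lt_zero _)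
  have hcard : 0 < S.card := Finset.card_pos.2 ⟨_, h0⟩
  refine ⟨S.card, hcard, fun a => (S.equivFin.symm a : Fin ob.k), fun j => ?_, ?_⟩
  · -- the smallest index with the same core as `j` is a representative
    set T : Finset (Fin ob.k) := Finset.univ.filter fun i => range (ob.core i) = range (ob.core j)
      with hT
    have hjT : j ∈ T := by simp [hT]
    have hTne : T.Nonempty := ⟨j, hjT⟩
    set i := T.min' hTne with hi
    have hiT : i ∈ T := Finset.min'_mem T hTne
    have hieq : range (ob.core i) = range (ob.core j) := by simpa [hT] using hiT
    have hiS : i ∈ S := by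
      rw [hmemS]
      intro j' hj' heq
      have hj'T : j' ∈ T := by simp [hT, heq, hieq]
      exact absurd (Finset.min'_le T j' hj'T) (not_le.2 (hi ▸ hj'))
    refine ⟨S.equivFin ⟨i, hiS⟩, ?_⟩
    simp [hieq]
  · intro a b hab
    have hne : (S.equivFin.symm a : Fin ob.k) ≠ S.equivFin.symm b := fun h =>
      hab (S.equivFin.symm.injective (Subtype.ext h))
    rcases ob.range_core_eq_or_disjoint (S.equivFin.symm a) (S.equivFin.symm b) with heq | hdis
    · exfalso
      have haS := (hmemS _).1 (S.equivFin.symm a).2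
      have hbS := (hmemS _).1 (S.equivFin.symm b).2
      rcases lt_or_gt_of_ne hne with hlt | hgt
      · exact hbS _ hlt heq
      · exact haS _ hgt heq.symm
    · exact hdis

/-! ### The flat parametrisation of a tube and its inverse -/

/-- The point `(ψ, x, y) ∈ ℝ³` with given angle `ψ` and disc coordinate `w = (x, y)`.
[folklore] -/
def mk3 (θ : ℝ) (w : 𝔼 2) : 𝔼 3 := WithLp.toLp 2 ![θ, w 0, w 1]

/-- The angle coordinate of `mk3 θ w` is `θ`. [folklore] -/
@[simp] theorem mk3_apply_zero (θ : ℝ) (w : 𝔼 2) : mk3 θ w 0 = θ := rfl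

/-- The disc coordinate of `mk3 θ w` is `w`. [folklore] -/
@[simp] theorem πw_mk3 (θ : ℝ) (w : 𝔼 2) : πw (mk3 θ w) = w := by
  ext i; fin_cases i <;> rfl

/-- `mk3 (p 0) (πw p) = p`: angle and disc coordinates determine the point. [folklore] -/
@[simp] theorem mk3_eta (p : 𝔼 3) : mk3 (p 0) (πw p) = p := by
  ext i; fin_cases i <;> rfl

/-- **The flat parametrisation of the `i`-th tube**:
`param i (ψ, x, y) = tube i (e^{iψ}, (x, y))` (Etnyre's coordinates `(ψ, (r, θ))`,
`(x, y) = r e^{iθ}`). [cite: Etnyre2006, proof of Lemma 3.3] -/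
def param (i : Fin ob.k) (p : 𝔼 3) : M :=
  ob.tube i (circlePoint (p 0), πw p)

/-- `param i (mk3 θ w) = tube i (e^{iθ}, w)`. [folklore] -/
theorem param_mk3 (i : Fin ob.k) (θ : ℝ) (w : 𝔼 2) :
    ob.param i (mk3 θ w) = ob.tube i (circlePoint θ, w) := by
  simp [param]

/-- The inner map `p ↦ (e^{iψ}, (x, y))` of the parametrisation is `C^∞`. [folklore] -/
theorem contMDiff_paramInner :
    ContMDiff (𝓡 3) ((𝓡 1).prod 𝓘(ℝ, 𝔼 2)) ∞ fun p : 𝔼 3 => (circlePoint (p 0), πw p) := by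
  refine ContMDiff.prodMk ?_ ?_
  · exact contMDiff_circlePoint.comp
      ((EuclideanSpace.proj (0 : Fin 3) : (𝔼 3) →L[ℝ] ℝ).contDiff.contMDiff)
  · exact πw.contDiff.contMDiff

/-- The parametrisation of a tube is `C^∞`. [folklore] -/
theorem contMDiff_param (i : Fin ob.k) : ContMDiff (𝓡 3) (𝓡 3) ∞ (ob.param i) :=
  (ob.isSmoothEmbedding_tube i).contMDiff.comp contMDiff_paramInner

/-- The parametrisation is continuous. [folklore] -/
theorem continuous_param (i : Fin ob.k) : Continuous (ob.param i) :=
  (ob.contMDiff_param i).continuous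

/-- Every point of the `i`-th tube over a set of disc coordinates is `param i (ψ, w)` with
`ψ ∈ [0, 2π)`. [folklore] -/
theorem exists_param_eq (i : Fin ob.k) (x : 𝕊 1) (w : 𝔼 2) :
    ∃ θ ∈ Ico (0 : ℝ) (2 * Real.pi), ob.param i (mk3 θ w) = ob.tube i (x, w) := by
  obtain ⟨θ₀, rfl⟩ := circlePoint_surjective x
  obtain ⟨θ, hθ, hθeq⟩ := periodic_circlePoint.exists_mem_Ico₀ Real.two_pi_pos θ₀
  exact ⟨θ, hθ, by rw [param_mk3, ← hθeq]⟩

/-- The image of the parametrisation is the image of the tube. [folklore] -/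
theorem range_param (i : Fin ob.k) : range (ob.param i) = range (ob.tube i) := by
  refine Subset.antisymm ?_ ?_
  · rintro _ ⟨p, rfl⟩; exact ⟨_, rfl⟩
  · rintro _ ⟨⟨x, w⟩, rfl⟩
    obtain ⟨θ, -, h⟩ := ob.exists_param_eq i x w
    exact ⟨_, h⟩

/-- `param i p` lies on the binding iff `x = y = 0`. [folklore] -/
theorem param_mem_binding_iff (i : Fin ob.k) (p : 𝔼 3) : ob.param i p ∈ ob.binding ↔ rho p = 0 := by
  rw [param, ob.tube_mem_binding_iff, πw_eq_zero_iff]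

omit [IsManifold (𝓡 3) ∞ M] in
/-- `𝕊¹ × ℝ²` is nonempty (needed to speak of `Function.invFun` of a tube). [folklore] -/
theorem nonempty_circleProd : Nonempty ((𝕊 1) × (𝔼 2)) := ⟨(circlePoint 0, 0)⟩

attribute [local instance] nonempty_circleProd

/-- **The disc coordinate `qmap i : M → ℝ²`**, `tube i (x, w) ↦ w` (junk off the image of the
tube): the inverse of the embedding followed by the projection. [folklore] -/
def qmap (i : Fin ob.k) (y : M) : 𝔼 2 :=
  (invFun (ob.tube i) y).2

/-- `qmap i (tube i (x, w)) = w`. [folklore] -/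
@[simp] theorem qmap_tube (i : Fin ob.k) (x : 𝕊 1) (w : 𝔼 2) : ob.qmap i (ob.tube i (x, w)) = w := by
  have h := leftInverse_invFun (ob.injective_tube i) (x, w)
  rw [qmap, h]

/-- `qmap i ∘ param i = πw`. [folklore] -/
theorem qmap_param (i : Fin ob.k) (p : 𝔼 3) : ob.qmap i (ob.param i p) = πw p := by
  rw [param, qmap_tube]

/-- `qmap i ∘ param i = πw` as functions. [folklore] -/
theorem qmap_comp_param (i : Fin ob.k) : ob.qmap i ∘ ob.param i = πw :=
  funext (ob.qmap_param i)

/-- **`qmap i` is `C^∞` at the points of the (open) image of the tube** (the inverse of a smooth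
embedding is smooth on its range, `contMDiffOn_invFun_range`). [folklore] -/
theorem contMDiffAt_qmap (i : Fin ob.k) {y : M} (hy : y ∈ range (ob.tube i)) :
    ContMDiffAt (𝓡 3) 𝓘(ℝ, 𝔼 2) ∞ (ob.qmap i) y := by
  have h1 : ContMDiffAt (𝓡 3) ((𝓡 1).prod 𝓘(ℝ, 𝔼 2)) ∞ (invFun (ob.tube i)) y :=
    (Literature.Geometry.Manifold.contMDiffOn_invFun_range (ob.isSmoothEmbedding_tube i)).contMDiffAt
      ((ob.isOpen_range_tube i).mem_nhds hy)
  have hq : ob.qmap i = Prod.snd ∘ invFun (ob.tube i) := rfl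
  rw [hq]
  exact contMDiffAt_snd.comp y h1

/-- `qmap i` is `C^∞` at `param i p`. [folklore] -/
theorem contMDiffAt_qmap_param (i : Fin ob.k) (p : 𝔼 3) :
    ContMDiffAt (𝓡 3) 𝓘(ℝ, 𝔼 2) ∞ (ob.qmap i) (ob.param i p) :=
  ob.contMDiffAt_qmap i ⟨_, rfl⟩

/-- **The chain rule `d(qmap) ∘ d(param) = πw`** (from `qmap ∘ param = πw`). [folklore] -/
theorem mfderiv_qmap_comp_param (i : Fin ob.k) (p : 𝔼 3) (v : 𝔼 3) :
    mfderiv (𝓡 3) 𝓘(ℝ, 𝔼 2) (ob.qmap i) (ob.param i p) (mfderiv (𝓡 3) (𝓡 3) (ob.param i) p v) =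
      πw v := by
  have hq : MDifferentiableAt (𝓡 3) 𝓘(ℝ, 𝔼 2) (ob.qmap i) (ob.param i p) :=
    (ob.contMDiffAt_qmap_param i p).mdifferentiableAt (by simp)
  have hp : MDifferentiableAt (𝓡 3) (𝓡 3) (ob.param i) p :=
    (ob.contMDiff_param i p).mdifferentiableAt (by simp)
  have h := mfderiv_comp p hq hp
  rw [ob.qmap_comp_param i, πw.mfderiv_eq] at h
  exact (ContinuousLinearMap.ext_iff.1 h v).symm

/-- **`rhoN i = ‖qmap i‖² = r²`** on the `i`-th tube (junk elsewhere). [folklore] -/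
def rhoN (i : Fin ob.k) (y : M) : ℝ := ‖ob.qmap i y‖ ^ 2

/-- `rhoN i (param i p) = rho p`. [folklore] -/
theorem rhoN_param (i : Fin ob.k) (p : 𝔼 3) : ob.rhoN i (ob.param i p) = rho p := by
  rw [rhoN, qmap_param, norm_πw_sq]

/-- `rhoN i (tube i (x, w)) = ‖w‖²`. [folklore] -/
theorem rhoN_tube (i : Fin ob.k) (x : 𝕊 1) (w : 𝔼 2) : ob.rhoN i (ob.tube i (x, w)) = ‖w‖ ^ 2 := by
  rw [rhoN, qmap_tube]

/-- `rhoN i` is `C^∞` at the points of the image of the tube. [folklore] -/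
theorem contMDiffAt_rhoN (i : Fin ob.k) {y : M} (hy : y ∈ range (ob.tube i)) :
    ContMDiffAt (𝓡 3) 𝓘(ℝ, ℝ) ∞ (ob.rhoN i) y :=
  ((contDiff_norm_sq ℝ (n := ∞)).contDiffAt.contMDiffAt).comp y (ob.contMDiffAt_qmap i hy)

/-! ### The frame of the parametrisation -/

/-- A vector of `ℝ¹` is its coordinate times the basis vector. [folklore] -/
theorem euclideanSpace_one_eq (u : 𝔼 1) : u = u 0 • EuclideanSpace.single (0 : Fin 1) (1 : ℝ) := by
  ext i
  fin_cases i
  simp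

/-- **The scaling factor `c` of the angular frame vector**: the velocity
`d(circlePoint)_θ(1) ∈ T𝕊¹ = ℝ¹` read in the chart of the circle, a nonzero real number.
[folklore] -/
def circleSpeed (θ : ℝ) : ℝ :=
  (show 𝔼 1 from mfderiv 𝓘(ℝ, ℝ) (𝓡 1) circlePoint θ (1 : ℝ)) 0

/-- `d(circlePoint)_θ(1) = circleSpeed θ • (basis vector of ℝ¹)`. [folklore] -/
theorem mfderiv_circlePoint_one (θ : ℝ) :
    mfderiv 𝓘(ℝ, ℝ) (𝓡 1) circlePoint θ (1 : ℝ) =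
      circleSpeed θ • EuclideanSpace.single (0 : Fin 1) (1 : ℝ) :=
  euclideanSpace_one_eq _

/-- `circleSpeed θ ≠ 0` (`circlePoint` is an immersion). [folklore] -/
theorem circleSpeed_ne_zero (θ : ℝ) : circleSpeed θ ≠ 0 := by
  intro h
  apply mfderiv_circlePoint_apply_ne_zero θ
  have h1 := mfderiv_circlePoint_one θ
  rw [h, zero_smul] at h1
  exact h1

/-- `d(circlePoint)_θ(c) = (c · circleSpeed θ) • (basis vector of ℝ¹)` (linearity in the real
variable). [folklore] -/
theorem mfderiv_circlePoint_real (θ c : ℝ) :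
    mfderiv 𝓘(ℝ, ℝ) (𝓡 1) circlePoint θ c =
      (c * circleSpeed θ) • EuclideanSpace.single (0 : Fin 1) (1 : ℝ) := by
  calc mfderiv 𝓘(ℝ, ℝ) (𝓡 1) circlePoint θ c = mfderiv 𝓘(ℝ, ℝ) (𝓡 1) circlePoint θ (c • (1 : ℝ)) := by
        rw [smul_eq_mul, mul_one]
    _ = c • mfderiv 𝓘(ℝ, ℝ) (𝓡 1) circlePoint θ (1 : ℝ) := map_smul _ _ _
    _ = (c * circleSpeed θ) • EuclideanSpace.single (0 : Fin 1) (1 : ℝ) := by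
        rw [mfderiv_circlePoint_one]
        show c • (circleSpeed θ • EuclideanSpace.single (0 : Fin 1) (1 : ℝ) : 𝔼 1) = _
        rw [smul_smul]

/-- The differential of the inner map `p ↦ (e^{iψ}, πw p)`:
`v ↦ (v₀ • d(circlePoint)(1), πw v)`. [folklore] -/
theorem hasMFDerivAt_paramInner (p : 𝔼 3) :
    HasMFDerivAt (𝓡 3) ((𝓡 1).prod 𝓘(ℝ, 𝔼 2)) (fun q : 𝔼 3 => (circlePoint (q 0), πw q)) p
      (((mfderiv 𝓘(ℝ, ℝ) (𝓡 1) circlePoint (p 0)).comp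
        (EuclideanSpace.proj (0 : Fin 3) : (𝔼 3) →L[ℝ] ℝ)).prod πw) := by
  refine HasMFDerivAt.prodMk ?_ πw.hasMFDerivAt
  have h1 : HasMFDerivAt 𝓘(ℝ, ℝ) (𝓡 1) circlePoint (p 0)
      (mfderiv 𝓘(ℝ, ℝ) (𝓡 1) circlePoint (p 0)) :=
    (contMDiff_circlePoint.mdifferentiableAt (by simp)).hasMFDerivAt
  have h2 : HasMFDerivAt (𝓡 3) 𝓘(ℝ, ℝ) (fun q : 𝔼 3 => q 0) p
      (EuclideanSpace.proj (0 : Fin 3) : (𝔼 3) →L[ℝ] ℝ) :=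
    (EuclideanSpace.proj (0 : Fin 3) : (𝔼 3) →L[ℝ] ℝ).hasMFDerivAt
  exact h1.comp p h2

/-- **The frame of the parametrisation**: for `v ∈ ℝ³`,
`d(param i)_p v = d(tube i)_{(e^{iψ}, w)} (v₀ c • 1, πw v)` with `c = circleSpeed ψ`. [folklore] -/
theorem mfderiv_param_apply (i : Fin ob.k) (p v : 𝔼 3) :
    mfderiv (𝓡 3) (𝓡 3) (ob.param i) p v =
      mfderiv ((𝓡 1).prod 𝓘(ℝ, 𝔼 2)) (𝓡 3) (ob.tube i) (circlePoint (p 0), πw p)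
        ((v 0 * circleSpeed (p 0)) • EuclideanSpace.single (0 : Fin 1) (1 : ℝ), πw v) := by
  have ht : MDifferentiableAt ((𝓡 1).prod 𝓘(ℝ, 𝔼 2)) (𝓡 3) (ob.tube i) (circlePoint (p 0), πw p) :=
    ((ob.isSmoothEmbedding_tube i).contMDiff _).mdifferentiableAt (by simp)
  have hcomp : HasMFDerivAt (𝓡 3) (𝓡 3) (ob.param i) p
      ((mfderiv ((𝓡 1).prod 𝓘(ℝ, 𝔼 2)) (𝓡 3) (ob.tube i) (circlePoint (p 0), πw p)).comp
        (((mfderiv 𝓘(ℝ, ℝ) (𝓡 1) circlePoint (p 0)).comp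
          (EuclideanSpace.proj (0 : Fin 3) : (𝔼 3) →L[ℝ] ℝ)).prod πw)) :=
    ht.hasMFDerivAt.comp p (hasMFDerivAt_paramInner p)
  rw [hcomp.mfderiv]
  show mfderiv ((𝓡 1).prod 𝓘(ℝ, 𝔼 2)) (𝓡 3) (ob.tube i) (circlePoint (p 0), πw p)
      (mfderiv 𝓘(ℝ, ℝ) (𝓡 1) circlePoint (p 0) (v 0), πw v) = _
  rw [mfderiv_circlePoint_real]

/-- The frame vector `∂_ψ tube` at `(x, w)` (at `w = 0` this is `coreTangent`). [folklore] -/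
def psiTangent (i : Fin ob.k) (x : 𝕊 1) (w : 𝔼 2) : 𝔼 3 :=
  mfderiv ((𝓡 1).prod 𝓘(ℝ, 𝔼 2)) (𝓡 3) (ob.tube i) (x, w) (EuclideanSpace.single (0 : Fin 1) (1 : ℝ), 0)

/-- The frame vectors `∂_{w_j} tube` at `(x, w)` (at `w = 0` these are `discFrame`). [folklore] -/
def wTangent (i : Fin ob.k) (x : 𝕊 1) (w : 𝔼 2) (j : Fin 2) : 𝔼 3 :=
  mfderiv ((𝓡 1).prod 𝓘(ℝ, 𝔼 2)) (𝓡 3) (ob.tube i) (x, w) (0, EuclideanSpace.single j (1 : ℝ))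

/-- On the core `psiTangent` is `coreTangent`. [folklore] -/
theorem psiTangent_zero (i : Fin ob.k) (x : 𝕊 1) : ob.psiTangent i x 0 = ob.coreTangent i x := rfl

/-- On the core `wTangent` is `discFrame`. [folklore] -/
theorem wTangent_zero (i : Fin ob.k) (x : 𝕊 1) (j : Fin 2) : ob.wTangent i x 0 j = ob.discFrame i x j :=
  rfl

/-- `πw e₀ = 0`. [folklore] -/
theorem πw_stdBasis3_zero : πw (stdBasis3 0) = 0 := by
  ext j; fin_cases j <;> simp [stdBasis3_apply]

/-- `πw e₁ = (1, 0)`. [folklore] -/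
theorem πw_stdBasis3_one : πw (stdBasis3 1) = EuclideanSpace.single (0 : Fin 2) (1 : ℝ) := by
  ext j; fin_cases j <;> simp [stdBasis3_apply]

/-- `πw e₂ = (0, 1)`. [folklore] -/
theorem πw_stdBasis3_two : πw (stdBasis3 2) = EuclideanSpace.single (1 : Fin 2) (1 : ℝ) := by
  ext j; fin_cases j <;> simp [stdBasis3_apply]

/-- **`d(param) e₀ = c • ∂_ψ tube`.** [folklore] -/
theorem mfderiv_param_stdBasis3_zero (i : Fin ob.k) (p : 𝔼 3) :
    mfderiv (𝓡 3) (𝓡 3) (ob.param i) p (stdBasis3 0) =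
      (circleSpeed (p 0) • ob.psiTangent i (circlePoint (p 0)) (πw p) : 𝔼 3) := by
  rw [mfderiv_param_apply, πw_stdBasis3_zero, psiTangent]
  have hv : ((((stdBasis3 0 : 𝔼 3) 0 * circleSpeed (p 0)) • EuclideanSpace.single (0 : Fin 1) (1 : ℝ),
      (0 : 𝔼 2)) : (𝔼 1) × (𝔼 2)) =
      circleSpeed (p 0) • ((EuclideanSpace.single (0 : Fin 1) (1 : ℝ), (0 : 𝔼 2)) : (𝔼 1) × (𝔼 2)) := by
    rw [stdBasis3_apply, PiLp.single_apply]
    simp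
  rw [hv]
  exact ContinuousLinearMap.map_smul
    (mfderiv ((𝓡 1).prod 𝓘(ℝ, 𝔼 2)) (𝓡 3) (ob.tube i) (circlePoint (p 0), πw p)) (circleSpeed (p 0))
    ((EuclideanSpace.single (0 : Fin 1) (1 : ℝ), (0 : 𝔼 2)) : (𝔼 1) × (𝔼 2))

/-- **`d(param) e₁ = ∂_{w₁} tube`.** [folklore] -/
theorem mfderiv_param_stdBasis3_one (i : Fin ob.k) (p : 𝔼 3) :
    mfderiv (𝓡 3) (𝓡 3) (ob.param i) p (stdBasis3 1) = ob.wTangent i (circlePoint (p 0)) (πw p) 0 := by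
  rw [mfderiv_param_apply, πw_stdBasis3_one, wTangent]
  congr 1
  refine Prod.ext ?_ rfl
  show ((stdBasis3 1 : 𝔼 3) 0 * circleSpeed (p 0)) • EuclideanSpace.single (0 : Fin 1) (1 : ℝ) = 0
  rw [stdBasis3_apply, PiLp.single_apply]; simp

/-- **`d(param) e₂ = ∂_{w₂} tube`.** [folklore] -/
theorem mfderiv_param_stdBasis3_two (i : Fin ob.k) (p : 𝔼 3) :
    mfderiv (𝓡 3) (𝓡 3) (ob.param i) p (stdBasis3 2) = ob.wTangent i (circlePoint (p 0)) (πw p) 1 := by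
  rw [mfderiv_param_apply, πw_stdBasis3_two, wTangent]
  congr 1
  refine Prod.ext ?_ rfl
  show ((stdBasis3 2 : 𝔼 3) 0 * circleSpeed (p 0)) • EuclideanSpace.single (0 : Fin 1) (1 : ℝ) = 0
  rw [stdBasis3_apply, PiLp.single_apply]; simp

end OpenBook

end Literature.Geometry.Symplectic

end
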